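import Summits.BirchSwinnertonDyer.BirchSwinnertonDyer.Theses.SignedLowerHalves
import Summits.BirchSwinnertonDyer.Rank1Residual.Supersingular.KobayashiMainConjectureX6BSTWScope
import Summits.BirchSwinnertonDyer.Rank1Residual.Supersingular.X6VisibilityTamDefectRecords
import Summits.BirchSwinnertonDyer.Rank1Residual.Supersingular.X6VisibilityTamDefectRecordsB
import Mathlib.Tactic.NormNum.LegendreSymbol
import HarnessLib

/-!
# Route `SignedLowerHalves`, crux `KobayashiLowerHalfSemistable` (item stmt-BirchSwinnertonDyer-19000): the
# registered stub `stub_five_le` and the crux from the SCOPED OPEN binder (cell-verified reading of BSTW Thm 1.3),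
# and KERNEL-CHECKED scope witnesses for the X6 rank-0 residue cells at `p ≥ 5` (cell `bsd-ssimc`, seat
# `bsd-ssimc-k3-c2` gen 0, planner fragment row k3-c2 (2)(3); a `--supports … --as helper` file, closes nothing)

PARTITION (cell bsd-ssimc): X6 ∧ r = 0 (A6) × the `p ≥ 5` cells (`22678e1 @ 5` + X6~ `492414f1 @ 5`, `130798a1 @ 7`),
X6 r1, literal rows D1/D2 — types-the-object-of; closes NONE. HONEST FRAMING: nothing here proves Kobayashi's
conjecture for any curve; the binder `BurungaleSkinnerTianWan2024_thm13_scoped_OPEN`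
(`Supersingular/KobayashiMainConjectureX6BSTWScope.lean`) is the CELL-VERIFIED SCOPE of an UNREFEREED preprint
(BSTW arXiv:2409.01350 Thm 1.3 at `p ≥ 5` with the (α) rider «an S2-auxiliary `L` with `p ∤ h_L` exists»;
REPORT-bstw-6 7a95ba616d84dc36, NOTE-W-ref-2); BSD is not proved by any of this; the item stays OPEN.

Contents.
* `stub_five_le_of_thm13_scoped_OPEN` — the registered stub (`p ≥ 5`) VERBATIM from the scoped binder AND the
  class-wide L-witness hypothesis `hwit` (the honest extra cost of the `p ≥ 5` half beyond the cell's verified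
  reading; NOT free class-wide — bstw-MEMO-4's Wiles-2015 bracket; decidable per class).
* `KobayashiLowerHalfSemistable_of_thm13_scoped_OPEN_of_stub_three` — the crux BY NAME from the scoped binder,
  `hwit`, and the registered `stub_three` taken as a hypothesis (`p = 3` is outside the verified scope: BSTW's own
  clause rests on the preprint [SV-S-Ohta], residual (3-ii)♭, REPORT-bstw-7 / RELAY-6).
* UNCONDITIONAL kernel L-witnesses (`BSTWScope.HasWitness`) for the three X6 rank-0 residue cells of the cell window
  at `p ≥ 5`: `22678e1 @ 5` (q = 23, L = ℚ(√−151), h = 7), `492414f1 @ 5` (q = 59, L = ℚ(√−311), h = 19),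
  `130798a1 @ 7` (q = 17, L = ℚ(√−167), h = 11) — (ram) prime and reduction data read off Cremona's minimal model
  (`Rank1Residual.IntModel`), Kronecker symbols by `norm_num`, form class numbers by `decide +kernel`; so on these
  pairs the (α) rider is DISCHARGED and `KobayashiLowerDivisibility` (both signs) / `BSD(E,p)` (22678e1, r0) hold
  MODULO ONLY the scoped PRE binder (+ published facts by name). NOT bookings.

References: [BurungaleSkinnerTianWan2024] Thm 1.3, II §2.3 (PRE); [Kobayashi2003] Conjecture (p. 2); [Cox2013]
Thm 2.13 / 7.7(ii); [Cremona2006] Table 1; cell records REPORT-bstw-6/7, NOTE-W-ref-2, bstw-MEMO-1 S1/S2/G3, k3c2-MEMO-1.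
-/

set_option autoImplicit false
set_option linter.dupNamespace false

noncomputable section

namespace Summit.BirchSwinnertonDyer.BirchSwinnertonDyer.Theorems

open scoped Classical MatrixGroups ModularForm

open CongruenceSubgroup WeierstrassCurve NumberField Literature.NumberTheory.EllipticCurves
  Literature.NumberTheory.EllipticCurves.ModularForms
  Literature.NumberTheory.EllipticCurves.Rank1Residual
  Literature.NumberTheory.EllipticCurves.Rank1Residual.Typed
  Literature.NumberTheory.EllipticCurves.Rank1Residual.X11RankOneCertificates
  Summit.BirchSwinnertonDyer.Rank1Residual.Supersingular
  Summit.BirchSwinnertonDyer.Rank1Residual.X11b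
  Summit.BirchSwinnertonDyer.BirchSwinnertonDyer.Rank1Residual.IntModel

/-! ### The registered stub `stub_five_le` and the crux, from the SCOPED binder -/

/-- **`stub_five_le` (verbatim header) MODULO the SCOPED OPEN binder AND class-wide scope witnesses.**
IF the cell-verified scope of BSTW Thm 1.3 holds (`hBSTW : BurungaleSkinnerTianWan2024_thm13_scoped_OPEN`,
UNREFEREED) AND every X6 pair at `p ≥ 5` admits a (ram) prime / auxiliary imaginary quadratic field with
`p ∤ h_L` (`hwit` — NOT free class-wide: bstw-MEMO-4's Wiles-2015 bracket; decidable per class), then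
`∃ ε, KobayashiLowerDivisibility W p ε` on X6 at every `p ≥ 5`. This displays exactly what the p ≥ 5
half of crux 2 costs beyond the cell's verified reading: the L-WITNESS. CONDITIONAL; closes nothing.
[claim: BurungaleSkinnerTianWan2024, status: under-review] [cite: Kobayashi2003, Conjecture (Main Conjecture) (p. 2)] -/
theorem stub_five_le_of_thm13_scoped_OPEN (hBSTW : BurungaleSkinnerTianWan2024_thm13_scoped_OPEN)
    (hwit : ∀ (W : WeierstrassCurve ℚ) [W.IsElliptic] [W.IsGloballyMinimal] (p : ℕ) [Fact p.Prime],
      5 ≤ p → ClassX6 W p → BSTWScope.HasWitness W p) :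
    ∀ (W : WeierstrassCurve ℚ) [W.IsElliptic] [W.IsGloballyMinimal] (p : ℕ) [Fact p.Prime],
      p ≠ 2 → Literature.NumberTheory.EllipticCurves.Rank1Residual.ClassX6 W p → 5 ≤ p →
      ∃ ε : ℤˣ, Summit.BirchSwinnertonDyer.Rank1Residual.Supersingular.KobayashiLowerDivisibility W p ε := by
  intro W _ _ p _ _hp hX h5
  exact ⟨1, X6.kobayashiLowerDivisibility_of_thm13_scoped_OPEN W p hBSTW h5 hX (hwit W p h5 hX) 1⟩

/-- **The crux BY NAME from the SCOPED binder, the class-wide witnesses, and the `p = 3` stub.** What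
`KobayashiLowerHalfSemistable` reduces to on the cell's reading of record: (i) the scoped OPEN binder
(cell-verified at `p ≥ 5`, PRE source), (ii) the L-witnesses, (iii) the registered stub `stub_three`
(`p = 3`: BSTW's own clause rests on the preprint [SV-S-Ohta]; located residual (3-ii)♭, REPORT-bstw-7)
taken verbatim as a hypothesis. CONDITIONAL (`conditional-result`); the item stays OPEN.
[claim: BurungaleSkinnerTianWan2024, status: under-review] [cite: Kobayashi2003, Conjecture (Main Conjecture) (p. 2)] -/
theorem KobayashiLowerHalfSemistable_of_thm13_scoped_OPEN_of_stub_three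
    (hBSTW : BurungaleSkinnerTianWan2024_thm13_scoped_OPEN)
    (hwit : ∀ (W : WeierstrassCurve ℚ) [W.IsElliptic] [W.IsGloballyMinimal] (p : ℕ) [Fact p.Prime],
      5 ≤ p → ClassX6 W p → BSTWScope.HasWitness W p)
    (hthree : ∀ (W : WeierstrassCurve ℚ) [W.IsElliptic] [W.IsGloballyMinimal],
      Literature.NumberTheory.EllipticCurves.Rank1Residual.ClassX6 W 3 →
      ∃ ε : ℤˣ, Summit.BirchSwinnertonDyer.Rank1Residual.Supersingular.KobayashiLowerDivisibility W 3 ε) :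
    Summit.BirchSwinnertonDyer.BirchSwinnertonDyer.Theses.SignedLowerHalves.KobayashiLowerHalfSemistable := by
  intro W _ _ p hpF hp hX
  by_cases h5 : 5 ≤ p
  · exact stub_five_le_of_thm13_scoped_OPEN hBSTW hwit W p hp hX h5
  · have h2 := hpF.out.two_le
    have hlt : p < 5 := Nat.lt_of_not_le h5
    interval_cases p
    · exact absurd rfl hp
    · exact hthree W hX
    · exact absurd hpF.out (by decide)

/-! ### The A6 cell `22678e1 @ 5` is INSIDE the verified scope: a kernel-checked L-witness -/

/-- **L-witness for `22678e1` at `p = 5` (row (i) of the cell's W-bstw-10 table, in the kernel):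
`q = 23`, `L = ℚ(√−151)`.** `22678e1 = [1,0,0,3140254662,−139987982322460]`, `N = 2·17·23·29`,
`Δ_min = −2⁷⁵·17·23·29⁴`, `gcd(Δ, c₄) = 1`; the (ram) prime `q = 23` (`ord₂₃ Δ = 1`, `5 ∤ 1`); `−151` is a
(prime) fundamental discriminant with `(−151/5) = (−151/2) = (−151/17) = (−151/29) = +1` (split: `5`, and
the primes `2, 17, 29` of `N/23`), `(−151/23) = −1` (inert), `(151, 2N) = 1`, and `h(−151) = 7`, `5 ∤ 7`
(form class number by `decide`). Hence `BSTWScope.HasWitness W 5`. Unconditional; per pair; closes nothing.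
[cite: Cremona2006, Table 1 (Cremona label 22678e1)] [cite: Cox2013, Thm. 2.13 (h(−151) = 7 by reduced forms)] -/
theorem BSTWScope_hasWitness_c22678e1_5 {W : WeierstrassCurve ℚ} [W.IsElliptic] [W.IsGloballyMinimal]
    (hWeq : W = ⟨1, 0, 0, 3140254662, -139987982322460⟩) :
    haveI : Fact (Nat.Prime 5) := ⟨by norm_num⟩
    BSTWScope.HasWitness W 5 := by
  haveI : Fact (Nat.Prime 5) := ⟨by norm_num⟩
  haveI h23 : Fact (Nat.Prime 23) := ⟨by norm_num⟩
  have hIW : integralModelInt W = ⟨1, 0, 0, 3140254662, -139987982322460⟩ :=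
    integralModelInt_eq_of_map_eq _ (by rw [hWeq]; ext <;> simp [WeierstrassCurve.map])
  -- every bad prime divides Δ(E₀) = −2⁷⁵·17·23·29⁴, hence lies in the list
  set Lp : List ℕ := [2, 17, 23, 29] with hLp
  have hLprime : ∀ q ∈ Lp, q.Prime := by decide
  have hΔE : ∀ q : ℕ, q.Prime → (q : ℤ) ∣ (⟨1, 0, 0, 3140254662, -139987982322460⟩ : WeierstrassCurve ℤ).Δ →
      q ∈ Lp :=
    forall_mem_of_natAbs_eq_prod_pow Lp [75, 1, 1, 4] hLprime (by decide +kernel)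
  have hbadmem : ∀ ℓ : ℕ, (hℓ : ℓ.Prime) →
      (haveI : Fact ℓ.Prime := ⟨hℓ⟩; ¬ W.HasGoodReductionAtPrime ℓ) → ℓ ∈ Lp := by
    intro ℓ hℓ hbad
    haveI : Fact ℓ.Prime := ⟨hℓ⟩
    have hd := natCast_dvd_minimalDiscriminantInt_of_not_hasGoodReductionAtPrime (W := W) ℓ hbad
    rw [minimalDiscriminantInt_eq hIW] at hd
    exact hΔE ℓ hℓ hd
  -- S1 at q = 23
  have haux : BSTWScope.IsAuxiliaryPrime W 5 23 := by
    refine ⟨by decide, hasMultiplicativeReductionAtPrime_of_intModel hIW 23 (by decide +kernel)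
      (by decide +kernel), ?_⟩
    rw [minimalDiscriminantInt_eq hIW,
      padicValInt_eq_of_dvd_of_not_dvd 23 (e := 1) (by decide +kernel) (by decide +kernel)]
    decide
  -- S2 + (α) with D = 151
  refine BSTWScope.hasWitness_of_kronecker W 5 (by decide) 23 haux 151 ⟨by norm_num, ?_, by norm_num⟩
    (by norm_num) (by norm_num) ?_ ?_ (fun _ => by norm_num) ?_
  · -- −151 is squarefree (151 is prime)
    exact Int.squarefree_natAbs.mp (by simpa using (by norm_num : Nat.Prime 151).squarefree)
  · intro ℓ hℓ hbad
    have hmem := hbadmem ℓ hℓ hbad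
    simp only [hLp, List.mem_cons, List.mem_nil_iff, or_false] at hmem
    rcases hmem with rfl | rfl | rfl | rfl <;> decide
  · intro ℓ hℓ hℓq hbad
    have hmem := hbadmem ℓ hℓ hbad
    simp only [hLp, List.mem_cons, List.mem_nil_iff, or_false] at hmem
    rcases hmem with rfl | rfl | rfl | rfl
    · exact ⟨fun _ => by norm_num, fun h => absurd rfl h⟩
    · exact ⟨fun h => absurd h (by decide), fun _ => by norm_num⟩
    · exact absurd rfl hℓq
    · exact ⟨fun h => absurd h (by decide), fun _ => by norm_num⟩
  · -- h(−151) = 7 is prime to 5 (form class number, kernel evaluation)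
    have h7 : Literature.NumberTheory.QuadraticFields.BinaryQuadraticForm.classNumber (-(151 : ℕ) : ℤ) = 7 := by
      decide +kernel
    rw [h7]; decide

/-- `ClassX6 W 5` for `22678e1` read off the integer model (good supersingular at `5`: `#Ẽ(𝔽₅) = 6`;
semistable: `gcd(Δ, c₄) = 1`) — as in the cell's record file `X6VisibilityTamDefectRecords`.
[cite: Cremona2006, Table 1 (Cremona label 22678e1)] [cite: SilvermanAEC2009, VII.5 Prop. 5.1(a) and (b)] -/
theorem classX6_c22678e1_5 {W : WeierstrassCurve ℚ} [W.IsElliptic] [W.IsGloballyMinimal]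
    (hWeq : W = ⟨1, 0, 0, 3140254662, -139987982322460⟩) :
    haveI : Fact (Nat.Prime 5) := ⟨by norm_num⟩
    ClassX6 W 5 := by
  haveI : Fact (Nat.Prime 5) := ⟨by norm_num⟩
  have hIW : integralModelInt W = ⟨1, 0, 0, 3140254662, -139987982322460⟩ :=
    integralModelInt_eq_of_map_eq _ (by rw [hWeq]; ext <;> simp [WeierstrassCurve.map])
  exact classX6_of_intModel 5 le_rfl hIW (by decide +kernel) card_c22678e1_5 (by decide) (by decide +kernel)

/-- **The Eisenstein half of Kobayashi's main conjecture for `22678e1` at `p = 5`, BOTH signs, MODULO ONLY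
the cell-verified-scope binder** (`hBSTW : BurungaleSkinnerTianWan2024_thm13_scoped_OPEN`, PRE): the scope
witness is the kernel theorem `BSTWScope_hasWitness_c22678e1_5`, the class is `classX6_c22678e1_5`. The one
A6 cell of the window at `p ≥ 5` (TARGET §1.1; RELAY-4 row (i)). CONDITIONAL on the PRE binder only; per
pair; closes nothing. [claim: BurungaleSkinnerTianWan2024, status: under-review]
[cite: Cremona2006, Table 1 (Cremona label 22678e1)] -/
theorem kobayashiLowerDivisibility_c22678e1_5_of_thm13_scoped_OPEN
    (hBSTW : BurungaleSkinnerTianWan2024_thm13_scoped_OPEN)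
    {W : WeierstrassCurve ℚ} [W.IsElliptic] [W.IsGloballyMinimal]
    (hWeq : W = ⟨1, 0, 0, 3140254662, -139987982322460⟩) (ε : ℤˣ) :
    haveI : Fact (Nat.Prime 5) := ⟨by norm_num⟩
    Summit.BirchSwinnertonDyer.Rank1Residual.Supersingular.KobayashiLowerDivisibility W 5 ε := by
  haveI : Fact (Nat.Prime 5) := ⟨by norm_num⟩
  exact X6.kobayashiLowerDivisibility_of_thm13_scoped_OPEN W 5 hBSTW le_rfl (classX6_c22678e1_5 hWeq)
    (BSTWScope_hasWitness_c22678e1_5 hWeq) ε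

/-- **`BSD(E,5)` for `22678e1` (X6, `r_an = 0`, `#Ш_an = 25`) MODULO the cell-verified-scope binder**, the rest
PUBLISHED and by name (Wuthrich Prop. 21, Kobayashi Thm. 1.2, B. D. Kim Cor. 3.15, Pollack, modularity,
GZK) plus the Cremona datum `r_an = 0` (`h0`, displayed binder). This is RELAY-4's row (i) «A6 @ p ≥ 5 =
22678e1 @ 5 with a per-class L-witness» in the kernel: the L-witness is DISCHARGED (`q = 23`,
`L = ℚ(√−151)`, `h = 7`), so the pair carries NO `BSTW13-hL-corner-open` flag — only the PRE status of the
engine itself ((A-γ), q₀ = 2 per REPORT-bstw-6). CONDITIONAL; per pair; NOT a booking.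
[claim: BurungaleSkinnerTianWan2024, status: under-review] [cite: Wuthrich2014, Prop. 21 (p. 400)]
[cite: Cremona2006, Table 1 (Cremona label 22678e1)] [cite: Miller2011LMS, §1 and Def. 1.1] -/
theorem bsdp_c22678e1_5_of_thm13_scoped_OPEN_of_analyticRank_eq_zero
    (hBSTW : BurungaleSkinnerTianWan2024_thm13_scoped_OPEN)
    (hW : Wuthrich2014.sha_dvd_analyticSha)
    (h12 : Kobayashi2003.thm12_signedSelmerDual_finite_torsion)
    (hKim : BDKim2013.cor315_signedCharValue_rankZero)
    (hmod : nonempty_modularParametrizationData) (hmod' : hasEntireLFunction_rat)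
    (hGZK : rank_eq_analyticRank_of_analyticRank_le_one)
    {W : WeierstrassCurve ℚ} [W.IsElliptic] [W.IsGloballyMinimal]
    (hWeq : W = ⟨1, 0, 0, 3140254662, -139987982322460⟩)
    (hPollack : ∀ {N : ℕ} [NeZero N] {f : CuspForm (Gamma0 N) 2},
      haveI : Fact (Nat.Prime 5) := ⟨by norm_num⟩
      pollack_exists_plusMinusPAdicLFunction (W := W) (f := f) (p := 5))
    (h0 : W.analyticRank = 0) :
    haveI : Fact (Nat.Prime 5) := ⟨by norm_num⟩
    BSDp W 5 := by
  haveI : Fact (Nat.Prime 5) := ⟨by norm_num⟩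
  exact X6.bsdp_of_thm13_scoped_OPEN_of_analyticRank_eq_zero W 5 hBSTW hW h12 hKim hPollack hmod hmod' hGZK
    le_rfl (classX6_c22678e1_5 hWeq) (BSTWScope_hasWitness_c22678e1_5 hWeq) h0

/-! ### Two more X6 rank-0 residue cells at `p ≥ 5` (the N4 TAM-DEFECT cells `492414f1 @ 5`, `130798a1 @ 7`) are INSIDE the scope -/

/-- **L-witness for `492414f1` at `p = 5`: `q = 59`, `L = ℚ(√−311)`.** `492414f1 = [1,1,1,−174686782448,−28102134435119791]`,
`N = 2·3·13·59·107`, `Δ_min = −2²⁰·3²⁸·13·59·107²`; (ram) primes at `5`: `3, 13, 59, 107`; `−311` prime fundamental, `≡ 1 (mod 8)`;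
`(−311/ℓ) = +1` for `ℓ ∈ {2, 3, 5, 13, 107}`, `(−311/59) = −1`; `h(−311) = 19`, `5 ∤ 19`. Unconditional; per pair; closes nothing.
[cite: Cremona2006, Table 1 (Cremona label 492414f1)] [cite: Cox2013, Thm. 2.13 (h(−311) = 19 by reduced forms)] -/
theorem BSTWScope_hasWitness_c492414f1_5 {W : WeierstrassCurve ℚ} [W.IsElliptic] [W.IsGloballyMinimal]
    (hWeq : W = ⟨1, 1, 1, -174686782448, -28102134435119791⟩) :
    haveI : Fact (Nat.Prime 5) := ⟨by norm_num⟩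
    BSTWScope.HasWitness W 5 := by
  haveI : Fact (Nat.Prime 5) := ⟨by norm_num⟩
  haveI h59 : Fact (Nat.Prime 59) := ⟨by norm_num⟩
  have hIW : integralModelInt W = ⟨1, 1, 1, -174686782448, -28102134435119791⟩ :=
    integralModelInt_eq_of_map_eq _ (by rw [hWeq]; ext <;> simp [WeierstrassCurve.map])
  set Lp : List ℕ := [2, 3, 13, 59, 107] with hLp
  have hLprime : ∀ q ∈ Lp, q.Prime := by decide
  have hΔE : ∀ q : ℕ, q.Prime →
      (q : ℤ) ∣ (⟨1, 1, 1, -174686782448, -28102134435119791⟩ : WeierstrassCurve ℤ).Δ → q ∈ Lp :=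
    forall_mem_of_natAbs_eq_prod_pow Lp [20, 28, 1, 1, 2] hLprime (by decide +kernel)
  have hbadmem : ∀ ℓ : ℕ, (hℓ : ℓ.Prime) →
      (haveI : Fact ℓ.Prime := ⟨hℓ⟩; ¬ W.HasGoodReductionAtPrime ℓ) → ℓ ∈ Lp := by
    intro ℓ hℓ hbad
    haveI : Fact ℓ.Prime := ⟨hℓ⟩
    have hd := natCast_dvd_minimalDiscriminantInt_of_not_hasGoodReductionAtPrime (W := W) ℓ hbad
    rw [minimalDiscriminantInt_eq hIW] at hd
    exact hΔE ℓ hℓ hd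
  have haux : BSTWScope.IsAuxiliaryPrime W 5 59 := by
    refine ⟨by decide, hasMultiplicativeReductionAtPrime_of_intModel hIW 59 (by decide +kernel)
      (by decide +kernel), ?_⟩
    rw [minimalDiscriminantInt_eq hIW,
      padicValInt_eq_of_dvd_of_not_dvd 59 (e := 1) (by decide +kernel) (by decide +kernel)]
    decide
  refine BSTWScope.hasWitness_of_kronecker W 5 (by decide) 59 haux 311 ⟨by norm_num, ?_, by norm_num⟩
    (by norm_num) (by norm_num) ?_ ?_ (fun _ => by norm_num) ?_
  · exact Int.squarefree_natAbs.mp (by simpa using (by norm_num : Nat.Prime 311).squarefree)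
  · intro ℓ hℓ hbad
    have hmem := hbadmem ℓ hℓ hbad
    simp only [hLp, List.mem_cons, List.mem_nil_iff, or_false] at hmem
    rcases hmem with rfl | rfl | rfl | rfl | rfl <;> decide
  · intro ℓ hℓ hℓq hbad
    have hmem := hbadmem ℓ hℓ hbad
    simp only [hLp, List.mem_cons, List.mem_nil_iff, or_false] at hmem
    rcases hmem with rfl | rfl | rfl | rfl | rfl
    · exact ⟨fun _ => by norm_num, fun h => absurd rfl h⟩
    · exact ⟨fun h => absurd h (by decide), fun _ => by norm_num⟩
    · exact ⟨fun h => absurd h (by decide), fun _ => by norm_num⟩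
    · exact absurd rfl hℓq
    · exact ⟨fun h => absurd h (by decide), fun _ => by norm_num⟩
  · have h19 : Literature.NumberTheory.QuadraticFields.BinaryQuadraticForm.classNumber (-(311 : ℕ) : ℤ) = 19 := by
      decide +kernel
    rw [h19]; decide

/-- `#Ẽ(𝔽₇) = 8` for `130798a1` (`a₇ = 0`: good SUPERSINGULAR at `7`; kernel count). [folklore] -/
theorem card_c130798a1_7 :
    Nat.card (((⟨1, 1, 1, -1514781218, -22692641927633⟩ : WeierstrassCurve ℤ).map
      (Int.castRingHom (ZMod 7))).toAffine.Point) = 8 :=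
  haveI : Fact (Nat.Prime 7) := ⟨by norm_num⟩
  natCard_point_eq_of_countPoints 1 1 1 (-1514781218) (-22692641927633) 7 (by norm_num) (by decide +kernel)
    (by decide +kernel)

/-- **L-witness for `130798a1` at `p = 7`: `q = 17`, `L = ℚ(√−167)`.** `130798a1 = [1,1,1,−1514781218,−22692641927633]`, `N = 2·17·3847`,
`Δ_min = 2¹⁴·17³·3847²`; (ram) primes at `7`: `17` (ord 3), `3847` (ord 2) — NOT `2` (ord 14); `−167` prime fundamental, `≡ 1 (mod 8)`;
`(−167/2) = (−167/7) = (−167/3847) = +1`, `(−167/17) = −1`; `h(−167) = 11`, `7 ∤ 11`. Unconditional; per pair; closes nothing.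
[cite: Cremona2006, Table 1 (Cremona label 130798a1)] [cite: Cox2013, Thm. 2.13 (h(−167) = 11 by reduced forms)] -/
theorem BSTWScope_hasWitness_c130798a1_7 {W : WeierstrassCurve ℚ} [W.IsElliptic] [W.IsGloballyMinimal]
    (hWeq : W = ⟨1, 1, 1, -1514781218, -22692641927633⟩) :
    haveI : Fact (Nat.Prime 7) := ⟨by norm_num⟩
    BSTWScope.HasWitness W 7 := by
  haveI : Fact (Nat.Prime 7) := ⟨by norm_num⟩
  haveI h17 : Fact (Nat.Prime 17) := ⟨by norm_num⟩
  have hIW : integralModelInt W = ⟨1, 1, 1, -1514781218, -22692641927633⟩ :=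
    integralModelInt_eq_of_map_eq _ (by rw [hWeq]; ext <;> simp [WeierstrassCurve.map])
  set Lp : List ℕ := [2, 17, 3847] with hLp
  have hLprime : ∀ q ∈ Lp, q.Prime := by
    simp only [hLp, List.mem_cons, List.mem_nil_iff, or_false]
    rintro q (rfl | rfl | rfl) <;> norm_num
  have hΔE : ∀ q : ℕ, q.Prime →
      (q : ℤ) ∣ (⟨1, 1, 1, -1514781218, -22692641927633⟩ : WeierstrassCurve ℤ).Δ → q ∈ Lp :=
    forall_mem_of_natAbs_eq_prod_pow Lp [14, 3, 2] hLprime (by decide +kernel)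
  have hbadmem : ∀ ℓ : ℕ, (hℓ : ℓ.Prime) →
      (haveI : Fact ℓ.Prime := ⟨hℓ⟩; ¬ W.HasGoodReductionAtPrime ℓ) → ℓ ∈ Lp := by
    intro ℓ hℓ hbad
    haveI : Fact ℓ.Prime := ⟨hℓ⟩
    have hd := natCast_dvd_minimalDiscriminantInt_of_not_hasGoodReductionAtPrime (W := W) ℓ hbad
    rw [minimalDiscriminantInt_eq hIW] at hd
    exact hΔE ℓ hℓ hd
  have haux : BSTWScope.IsAuxiliaryPrime W 7 17 := by
    refine ⟨by decide, hasMultiplicativeReductionAtPrime_of_intModel hIW 17 (by decide +kernel)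
      (by decide +kernel), ?_⟩
    rw [minimalDiscriminantInt_eq hIW,
      padicValInt_eq_of_dvd_of_not_dvd 17 (e := 3) (by decide +kernel) (by decide +kernel)]
    decide
  refine BSTWScope.hasWitness_of_kronecker W 7 (by decide) 17 haux 167 ⟨by norm_num, ?_, by norm_num⟩
    (by norm_num) (by norm_num) ?_ ?_ (fun _ => by norm_num) ?_
  · exact Int.squarefree_natAbs.mp (by simpa using (by norm_num : Nat.Prime 167).squarefree)
  · intro ℓ hℓ hbad
    have hmem := hbadmem ℓ hℓ hbad
    simp only [hLp, List.mem_cons, List.mem_nil_iff, or_false] at hmem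
    rcases hmem with rfl | rfl | rfl <;> decide
  · intro ℓ hℓ hℓq hbad
    have hmem := hbadmem ℓ hℓ hbad
    simp only [hLp, List.mem_cons, List.mem_nil_iff, or_false] at hmem
    rcases hmem with rfl | rfl | rfl
    · exact ⟨fun _ => by norm_num, fun h => absurd rfl h⟩
    · exact absurd rfl hℓq
    · exact ⟨fun h => absurd h (by decide), fun _ => by norm_num⟩
  · have h11 : Literature.NumberTheory.QuadraticFields.BinaryQuadraticForm.classNumber (-(167 : ℕ) : ℤ) = 11 := by
      decide +kernel
    rw [h11]; decide

/-- **The Eisenstein half for `492414f1` at `5`, both signs, MODULO ONLY the scoped binder** (class X6 read off the model: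
`classX6_of_intModel` with the tree's `card_c492414f1_5`). CONDITIONAL; per pair; closes nothing.
[claim: BurungaleSkinnerTianWan2024, status: under-review] [cite: Cremona2006, Table 1 (Cremona label 492414f1)] -/
theorem kobayashiLowerDivisibility_c492414f1_5_of_thm13_scoped_OPEN
    (hBSTW : BurungaleSkinnerTianWan2024_thm13_scoped_OPEN)
    {W : WeierstrassCurve ℚ} [W.IsElliptic] [W.IsGloballyMinimal]
    (hWeq : W = ⟨1, 1, 1, -174686782448, -28102134435119791⟩) (ε : ℤˣ) :
    haveI : Fact (Nat.Prime 5) := ⟨by norm_num⟩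
    Summit.BirchSwinnertonDyer.Rank1Residual.Supersingular.KobayashiLowerDivisibility W 5 ε := by
  haveI : Fact (Nat.Prime 5) := ⟨by norm_num⟩
  have hIW : integralModelInt W = ⟨1, 1, 1, -174686782448, -28102134435119791⟩ :=
    integralModelInt_eq_of_map_eq _ (by rw [hWeq]; ext <;> simp [WeierstrassCurve.map])
  have hX : ClassX6 W 5 :=
    classX6_of_intModel 5 le_rfl hIW (by decide +kernel) card_c492414f1_5 (by decide) (by decide +kernel)
  exact X6.kobayashiLowerDivisibility_of_thm13_scoped_OPEN W 5 hBSTW le_rfl hX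
    (BSTWScope_hasWitness_c492414f1_5 hWeq) ε

/-- **The Eisenstein half for `130798a1` at `7`, both signs, MODULO ONLY the scoped binder** (class X6 read off the model with the kernel
count `card_c130798a1_7`). CONDITIONAL; per pair; closes nothing.
[claim: BurungaleSkinnerTianWan2024, status: under-review] [cite: Cremona2006, Table 1 (Cremona label 130798a1)] -/
theorem kobayashiLowerDivisibility_c130798a1_7_of_thm13_scoped_OPEN
    (hBSTW : BurungaleSkinnerTianWan2024_thm13_scoped_OPEN)
    {W : WeierstrassCurve ℚ} [W.IsElliptic] [W.IsGloballyMinimal]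
    (hWeq : W = ⟨1, 1, 1, -1514781218, -22692641927633⟩) (ε : ℤˣ) :
    haveI : Fact (Nat.Prime 7) := ⟨by norm_num⟩
    Summit.BirchSwinnertonDyer.Rank1Residual.Supersingular.KobayashiLowerDivisibility W 7 ε := by
  haveI : Fact (Nat.Prime 7) := ⟨by norm_num⟩
  have hIW : integralModelInt W = ⟨1, 1, 1, -1514781218, -22692641927633⟩ :=
    integralModelInt_eq_of_map_eq _ (by rw [hWeq]; ext <;> simp [WeierstrassCurve.map])
  have hX : ClassX6 W 7 :=
    classX6_of_intModel 7 (by norm_num) hIW (by decide +kernel) card_c130798a1_7 (by decide) (by decide +kernel)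
  exact X6.kobayashiLowerDivisibility_of_thm13_scoped_OPEN W 7 hBSTW (by norm_num) hX
    (BSTWScope_hasWitness_c130798a1_7 hWeq) ε

end Summit.BirchSwinnertonDyer.BirchSwinnertonDyer.Theorems

end
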